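import Summits.Ventures.GridStability.Models.StructurePreservingInvariant
import Literature.Analysis.ODE.LyapunovSublevelInvariance
import HarnessLib

/-!
# GridStability/Lyapunov/StructurePreservingPhase — the structure-preserving model as a first-order
# ODE on the phase space `(Fin n → ℝ) × (Fin n → ℝ)`, its dissipation identity and first integrals

Cell `gridfusion` (LADDER-GRIDFUSION), `plan/PARTITION.md` §0 row `Lyapunov/` + A5″ (our ODE
packaging on the venture side), seat gridfusion-lyap-1 (g2). This is the «ODE plumbing» that
model-2 (INBOX 2026-08-26T21:06:34Z) and lit-2 (20:42:17Z) named as the only thing missing between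
the kernel-checked MODEL-SIDE ingredients of the Bergen–Hill structure-preserving model
(`Models/StructurePreserving*.lean`, model-2: the printed energy `V` [cite: Padiyar2013, §3.2 eq
(3.11)], `dV/dt = −Σ Dᵢ δ̇ᵢ²`, the quadratic sandwich `g(θ)·Q ≤ W ≤ Q`, the zero set of `W`, the
momentum first integral `L = Σ_gen Mᵢ δ̇ᵢ + Σ Dᵢ δᵢ` [cite: Padiyar2013, §3.2 eq (3.15)], isolation and
state bounds on `{L = L(δ₀, 0)}`) and the tree's Barbashin–Krasovskii–LaSalle theorem
(`Literature.Analysis.ODE.sublevel_subset_regionOfAttraction_of_noCompleteTrajectory`, lit-6 p463197),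
whose hypotheses are about a FIRST-ORDER field `F : E → E` on a proper normed space, a `C¹`
Lyapunov function with `V̇ = V' x (F x) ≤ 0`, an invariant constraint set `M`, an open `G` and a
compact sublevel piece `S = {x ∈ G ∩ M | V x ≤ c}`.

## Contents (all PROVED; MODELLED column: statements about MODEL MV-3 in the frame rotating at the
synchronous frequency `ω₀`, i.e. model-2's `p.shifted`, `P⁰ ↦ P̄`, `Σ P̄ᵢ = 0`)
* `phaseField p` — the model (3.2) as a vector field on `x = (δ, ω)`: `δ̇ᵢ = ωᵢ`,
  `ω̇ᵢ = (P̄ᵢ − Dᵢ ωᵢ − fᵢ(δ))/Mᵢ` at generator nodes; `δ̇ᵢ = (P̄ᵢ − fᵢ(δ))/Dᵢ` (first order,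
  frequency-dependent load) and `ω̇ᵢ = 0` at load buses (their `ωᵢ` is a dummy coordinate, pinned to
  `0` by the constraint set); `contDiff_phaseField` (`C¹`, for Picard–Lindelöf / Grönwall);
  `phaseField_balance` (every bus satisfies `Mᵢ aᵢ + Dᵢ vᵢ + fᵢ(δ) = P̄ᵢ`);
* `phaseEnergy p δ₀ x = p.energy δ₀ x.1 x.2`, `contDiff_phaseEnergy`, and the **dissipation identity**
  `fderiv_phaseEnergy_phaseField`: `V̇(x) = fderiv V x (F x) = −Σᵢ Dᵢ (δ̇ᵢ)²` at EVERY phase point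
  (line derivative `hasDerivAt_energy_line` + model-2's algebraic core `energyRate_eq`);
* first integrals: `fderiv_phaseMomentum_phaseField` (`L̇ = Σ P̄ᵢ − Σ fᵢ = 0`, losslessness) and the
  load-bus dummy frequencies; `mem_constraintSet_of_solution` (the constraint set
  `{L = L(δ₀,0)} ∩ {ω = 0 off gen}` is invariant along every solution, a priori);
* the sets: `window p` (`|δᵢ − δⱼ| < π/2` on coupled pairs, open), `constraintSet p δ₀` (closed),
  the threshold `levelBound θ β = c⋆ = g(θ)·β·(π/2 − θ)²/4` (`levelBound_pos`).
Compactness of the sublevel piece `{x ∈ window ∩ constraintSet | V x ≤ c}` for `c < c⋆` and the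
uniqueness of the synchronous equilibrium on a momentum level set are the sibling
`Lyapunov/StructurePreservingSublevel.lean`; the assembly (region of attraction of `(δ₀, 0)`, a
priori over all solutions, via Barbashin–Krasovskii) is `Lyapunov/StructurePreservingRoa.lean`. THREE COLUMNS: mathematics about the typed model MV-3
(MODEL-VALIDITY.md); no certificate data; no sentence about any grid.
-/

noncomputable section

open Set Filter Topology Real
open Summit.Ventures.GridStability.Models.StructurePreserving
open Summit.Ventures.GridStability.Models.StructurePreserving.Params

namespace Summit.Ventures.GridStability.Lyapunov.StructurePreserving

variable {n : ℕ}

/-! ### The first-order field on the phase space -/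

/-- **The structure-preserving model as a first-order vector field** on the phase space
`x = (δ, ω) ∈ (Fin n → ℝ) × (Fin n → ℝ)` (shifted frame, powers `P̄ᵢ`): at a generator node
`δ̇ᵢ = ωᵢ`, `ω̇ᵢ = (P̄ᵢ − Dᵢ ωᵢ − fᵢ(δ))/Mᵢ` [cite: Padiyar2013, §3.2 eq (3.2)]; at a load bus the
equation is first order, `δ̇ᵢ = (P̄ᵢ − fᵢ(δ))/Dᵢ` (frequency-dependent load), and the unused
coordinate `ωᵢ` is given zero velocity. MODELLED (MV-3). [folklore] -/
def phaseField (p : Params n) (x : (Fin n → ℝ) × (Fin n → ℝ)) : (Fin n → ℝ) × (Fin n → ℝ) :=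
  (fun i => if i ∈ p.gen then x.2 i else (p.Pbar i - p.pe x.1 i) / p.D i,
   fun i => if i ∈ p.gen then (p.Pbar i - p.D i * x.2 i - p.pe x.1 i) / p.M i else 0)

/-- Angle velocity at a generator node: `δ̇ᵢ = ωᵢ`. [folklore] -/
@[simp] theorem phaseField_fst_of_mem (p : Params n) (x : (Fin n → ℝ) × (Fin n → ℝ)) {i : Fin n}
    (hi : i ∈ p.gen) : (phaseField p x).1 i = x.2 i := by
  simp [phaseField, hi]

/-- Angle velocity at a load bus: `δ̇ᵢ = (P̄ᵢ − fᵢ(δ))/Dᵢ`. [folklore] -/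
@[simp] theorem phaseField_fst_of_not_mem (p : Params n) (x : (Fin n → ℝ) × (Fin n → ℝ))
    {i : Fin n} (hi : i ∉ p.gen) : (phaseField p x).1 i = (p.Pbar i - p.pe x.1 i) / p.D i := by
  simp [phaseField, hi]

/-- Frequency rate at a generator node: `ω̇ᵢ = (P̄ᵢ − Dᵢ ωᵢ − fᵢ(δ))/Mᵢ`. [folklore] -/
@[simp] theorem phaseField_snd_of_mem (p : Params n) (x : (Fin n → ℝ) × (Fin n → ℝ)) {i : Fin n}
    (hi : i ∈ p.gen) : (phaseField p x).2 i = (p.Pbar i - p.D i * x.2 i - p.pe x.1 i) / p.M i := by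
  simp [phaseField, hi]

/-- The dummy frequency coordinate of a load bus does not move. [folklore] -/
@[simp] theorem phaseField_snd_of_not_mem (p : Params n) (x : (Fin n → ℝ) × (Fin n → ℝ))
    {i : Fin n} (hi : i ∉ p.gen) : (phaseField p x).2 i = 0 := by
  simp [phaseField, hi]

/-- **Every bus satisfies the printed equation** `Mᵢ aᵢ + Dᵢ vᵢ + fᵢ(δ) = P̄ᵢ` with
`(v, a) = ((F x).1, (F x).2)` (well-formed data: `Mᵢ > 0` on generators, `Mᵢ = 0`, `Dᵢ > 0` on
loads) — the hypothesis of model-2's algebraic Lyapunov core `energyRate_eq`. [folklore] -/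
theorem phaseField_balance {p : Params n} (hp : p.WellFormed) (x : (Fin n → ℝ) × (Fin n → ℝ))
    (i : Fin n) :
    p.M i * (phaseField p x).2 i + p.D i * (phaseField p x).1 i + p.pe x.1 i = p.Pbar i := by
  by_cases hi : i ∈ p.gen
  · have hM := (hp.M_pos i hi).ne'
    rw [phaseField_fst_of_mem p x hi, phaseField_snd_of_mem p x hi]
    field_simp
    ring
  · have hD := (hp.D_pos i).ne'
    rw [phaseField_fst_of_not_mem p x hi, phaseField_snd_of_not_mem p x hi, hp.M_eq_zero i hi]
    field_simp
    ring

/-- The network injection `fᵢ(δ) = Σⱼ bᵢⱼ sin(δᵢ − δⱼ)` is `C¹` on the phase space. [folklore] -/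
theorem contDiff_pe (p : Params n) (i : Fin n) :
    ContDiff ℝ 1 fun x : (Fin n → ℝ) × (Fin n → ℝ) => p.pe x.1 i := by
  unfold Params.pe
  fun_prop

/-- The phase field is `C¹` (in fact real-analytic): Picard–Lindelöf, Grönwall and the tree's
continuation theorems apply. [folklore] -/
theorem contDiff_phaseField (p : Params n) : ContDiff ℝ 1 (phaseField p) := by
  refine ContDiff.prodMk (contDiff_pi.2 fun i => ?_) (contDiff_pi.2 fun i => ?_)
  · by_cases hi : i ∈ p.gen
    · simp only [hi, if_true]
      fun_prop
    · simp only [hi, if_false]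
      have h := contDiff_pe p i
      fun_prop
  · by_cases hi : i ∈ p.gen
    · simp only [hi, if_true]
      have h := contDiff_pe p i
      fun_prop
    · simp only [hi, if_false]
      exact contDiff_const

/-! ### The energy on the phase space and the dissipation identity -/

/-- Bergen–Hill's topological Lyapunov function read on the phase space:
`V(x) = p.energy δ₀ x.1 x.2 = ½ Σ_gen Mᵢ ωᵢ² + W(δ, δ₀)` [cite: Padiyar2013, §3.2 eq (3.11)]
(model-2's `Params.energy`, unchanged). [folklore] -/
def phaseEnergy (p : Params n) (δ₀ : Fin n → ℝ) (x : (Fin n → ℝ) × (Fin n → ℝ)) : ℝ :=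
  p.energy δ₀ x.1 x.2

/-- Unfolding lemma. [folklore] -/
@[simp] theorem phaseEnergy_apply (p : Params n) (δ₀ : Fin n → ℝ) (x : (Fin n → ℝ) × (Fin n → ℝ)) :
    phaseEnergy p δ₀ x = p.energy δ₀ x.1 x.2 := rfl

/-- The energy is `C¹` on the phase space. [folklore] -/
theorem contDiff_phaseEnergy (p : Params n) (δ₀ : Fin n → ℝ) : ContDiff ℝ 1 (phaseEnergy p δ₀) := by
  unfold phaseEnergy Params.energy Params.kinetic Params.potential Params.branchEnergy
  fun_prop

/-- **Derivative of the energy along a straight line** in phase space through `(δ, ω)` with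
velocity `(a, b)`, at the base point: `Σ_{gen} Mᵢ ωᵢ bᵢ + ½ Σᵢ Σⱼ bᵢⱼ (aᵢ − aⱼ)(sin(δᵢ−δⱼ) −
sin(δ₀ᵢ−δ₀ⱼ))` (term-by-term calculus; compare model-2's `hasDerivAt_energy_rate`). [folklore] -/
theorem hasDerivAt_energy_line (p : Params n) (δ₀ δ ω a b : Fin n → ℝ) :
    HasDerivAt (fun t : ℝ => p.energy δ₀ (fun i => δ i + t * a i) (fun i => ω i + t * b i))
      (∑ i ∈ p.gen, p.M i * ω i * b i
        + (1 / 2) * ∑ i, ∑ j, p.b i j * ((a i - a j) * (Real.sin (δ i - δ j)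
            - Real.sin (δ₀ i - δ₀ j)))) 0 := by
  have hlin : ∀ c d : ℝ, HasDerivAt (fun t : ℝ => c + t * d) d 0 := by
    intro c d
    simpa using ((hasDerivAt_id (0 : ℝ)).mul_const d).const_add c
  have hK : HasDerivAt (fun t : ℝ => p.kinetic fun i => ω i + t * b i)
      (∑ i ∈ p.gen, p.M i * ω i * b i) 0 := by
    have hsum : HasDerivAt (fun t : ℝ => ∑ i ∈ p.gen, p.M i * (ω i + t * b i) ^ 2)
        (∑ i ∈ p.gen, p.M i * (((2 : ℕ) : ℝ) * (ω i + 0 * b i) ^ (2 - 1) * b i)) 0 := by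
      refine HasDerivAt.fun_sum fun i _ => ?_
      exact ((hlin (ω i) (b i)).fun_pow 2).const_mul (p.M i)
    have h := hsum.const_mul (1 / 2 : ℝ)
    refine h.congr_deriv ?_
    rw [Finset.mul_sum]
    refine Finset.sum_congr rfl fun i _ => ?_
    push_cast
    ring
  have hP : HasDerivAt (fun t : ℝ => p.potential δ₀ fun i => δ i + t * a i)
      ((1 / 2) * ∑ i, ∑ j, p.b i j * ((a i - a j) * (Real.sin (δ i - δ j)
        - Real.sin (δ₀ i - δ₀ j)))) 0 := by
    refine HasDerivAt.const_mul (1 / 2 : ℝ) (HasDerivAt.fun_sum fun i _ => ?_)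
    refine HasDerivAt.fun_sum fun j _ => ?_
    have hσ : HasDerivAt (fun t : ℝ => (δ i + t * a i) - (δ j + t * a j)) (a i - a j) 0 :=
      (hlin (δ i) (a i)).fun_sub (hlin (δ j) (a j))
    have hbr : HasDerivAt (fun t : ℝ => branchEnergy ((δ i + t * a i) - (δ j + t * a j))
        (δ₀ i - δ₀ j)) ((a i - a j) * (Real.sin (δ i - δ j) - Real.sin (δ₀ i - δ₀ j))) 0 := by
      have h1 := hσ.cos.const_sub (Real.cos (δ₀ i - δ₀ j))
      have h2 := (hσ.sub_const (δ₀ i - δ₀ j)).mul_const (Real.sin (δ₀ i - δ₀ j))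
      refine (h1.fun_sub h2).congr_deriv ?_
      simp only [zero_mul, add_zero]
      ring
    exact hbr.const_mul (p.b i j)
  exact hK.fun_add hP

/-- **The dissipation identity of Bergen–Hill on the phase space**: for well-formed data and a
synchronous equilibrium `δ₀` of the shifted model, at EVERY phase point
`V̇(x) = DV(x)·F(x) = −Σᵢ Dᵢ (δ̇ᵢ)²` where `δ̇ = (F x).1` [cite: Padiyar2013, §3.2 eqs
(3.10)–(3.11)]; [cite: BergenHill1981]. Chain rule along the line `t ↦ x + t·F(x)`
(`hasDerivAt_energy_line`, uniqueness of the derivative) and model-2's algebraic core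
`energyRate_eq` with `phaseField_balance`. MODEL MV-3. [folklore] -/
theorem fderiv_phaseEnergy_phaseField {p : Params n} (hp : p.WellFormed) {δ₀ : Fin n → ℝ}
    (h₀ : p.IsSyncEquilibrium δ₀) (x : (Fin n → ℝ) × (Fin n → ℝ)) :
    fderiv ℝ (phaseEnergy p δ₀) x (phaseField p x)
      = -∑ i, p.D i * (phaseField p x).1 i ^ 2 := by
  set w := phaseField p x with hw
  -- the straight line through `x` with velocity `w`
  have hγ : HasDerivAt (fun t : ℝ =>
      ((fun i => x.1 i + t * w.1 i, fun i => x.2 i + t * w.2 i) : (Fin n → ℝ) × (Fin n → ℝ)))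
      w 0 := by
    have h1 : HasDerivAt (fun t : ℝ => fun i => x.1 i + t * w.1 i) w.1 0 :=
      hasDerivAt_pi.2 fun i => by
        simpa using ((hasDerivAt_id (0 : ℝ)).mul_const (w.1 i)).const_add (x.1 i)
    have h2 : HasDerivAt (fun t : ℝ => fun i => x.2 i + t * w.2 i) w.2 0 :=
      hasDerivAt_pi.2 fun i => by
        simpa using ((hasDerivAt_id (0 : ℝ)).mul_const (w.2 i)).const_add (x.2 i)
    exact h1.prodMk h2
  have hV : DifferentiableAt ℝ (phaseEnergy p δ₀) x :=
    ((contDiff_phaseEnergy p δ₀).differentiable one_ne_zero) x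
  have hcomp : HasDerivAt (fun t : ℝ => phaseEnergy p δ₀
      ((fun i => x.1 i + t * w.1 i, fun i => x.2 i + t * w.2 i) : (Fin n → ℝ) × (Fin n → ℝ)))
      (fderiv ℝ (phaseEnergy p δ₀) x w) 0 :=
    hV.hasFDerivAt.comp_hasDerivAt_of_eq (0 : ℝ) hγ (by simp)
  have hline := hasDerivAt_energy_line p δ₀ x.1 x.2 w.1 w.2
  have heq : fderiv ℝ (phaseEnergy p δ₀) x w = ∑ i ∈ p.gen, p.M i * x.2 i * w.2 i
      + (1 / 2) * ∑ i, ∑ j, p.b i j * ((w.1 i - w.1 j) * (Real.sin (x.1 i - x.1 j)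
          - Real.sin (δ₀ i - δ₀ j))) := hcomp.unique hline
  rw [heq]
  -- on generator nodes `w.1 i = x.2 i`, so this is `energyRate δ₀ x.1 w.1 w.2`
  have hkin : ∑ i ∈ p.gen, p.M i * x.2 i * w.2 i = ∑ i ∈ p.gen, p.M i * w.1 i * w.2 i :=
    Finset.sum_congr rfl fun i hi => by rw [hw, phaseField_fst_of_mem p x hi]
  have hrate := energyRate_eq hp h₀ (δ := x.1) (v := w.1) (a := w.2)
    (fun i => phaseField_balance hp x i)
  unfold energyRate at hrate
  rw [hkin]
  exact hrate

/-- The energy is differentiable with `V̇ ≤ 0` everywhere (all `Dᵢ > 0`). [folklore] -/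
theorem fderiv_phaseEnergy_phaseField_nonpos {p : Params n} (hp : p.WellFormed) {δ₀ : Fin n → ℝ}
    (h₀ : p.IsSyncEquilibrium δ₀) (x : (Fin n → ℝ) × (Fin n → ℝ)) :
    fderiv ℝ (phaseEnergy p δ₀) x (phaseField p x) ≤ 0 := by
  rw [fderiv_phaseEnergy_phaseField hp h₀ x, neg_nonpos]
  exact Finset.sum_nonneg fun i _ => mul_nonneg (hp.D_pos i).le (sq_nonneg _)

/-- `V̇(x) = 0` forces every angle velocity to vanish: `(F x).1 = 0` (all `Dᵢ > 0`). [folklore] -/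
theorem phaseField_fst_eq_zero_of_fderiv_eq_zero {p : Params n} (hp : p.WellFormed)
    {δ₀ : Fin n → ℝ} (h₀ : p.IsSyncEquilibrium δ₀) {x : (Fin n → ℝ) × (Fin n → ℝ)}
    (hx : fderiv ℝ (phaseEnergy p δ₀) x (phaseField p x) = 0) (i : Fin n) :
    (phaseField p x).1 i = 0 := by
  rw [fderiv_phaseEnergy_phaseField hp h₀ x, neg_eq_zero] at hx
  have hterm : ∀ j ∈ (Finset.univ : Finset (Fin n)), 0 ≤ p.D j * (phaseField p x).1 j ^ 2 :=
    fun j _ => mul_nonneg (hp.D_pos j).le (sq_nonneg _)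
  have h := (Finset.sum_eq_zero_iff_of_nonneg hterm).1 hx i (Finset.mem_univ i)
  have h2 : (phaseField p x).1 i ^ 2 = 0 := (mul_eq_zero.1 h).resolve_left (hp.D_pos i).ne'
  exact pow_eq_zero_iff (n := 2) (by norm_num) |>.1 h2

/-! ### First integrals: the momentum and the load-bus dummy frequencies -/

/-- The momentum functional on the phase space, `L(x) = Σ_{gen} Mᵢ ωᵢ + Σᵢ Dᵢ δᵢ` (model-2's
`Params.momentum`). [folklore] -/
def phaseMomentum (p : Params n) (x : (Fin n → ℝ) × (Fin n → ℝ)) : ℝ := p.momentum x.1 x.2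

/-- Unfolding lemma. [folklore] -/
@[simp] theorem phaseMomentum_apply (p : Params n) (x : (Fin n → ℝ) × (Fin n → ℝ)) :
    phaseMomentum p x = p.momentum x.1 x.2 := rfl

/-- The momentum is `C¹` (it is affine). [folklore] -/
theorem contDiff_phaseMomentum (p : Params n) : ContDiff ℝ 1 (phaseMomentum p) := by
  unfold phaseMomentum Params.momentum
  fun_prop

/-- **The momentum is a first integral of the phase field** (well-formed lossless data, `n ≠ 0`):
`DL(x)·F(x) = Σ_{gen}(P̄ᵢ − Dᵢωᵢ − fᵢ) + Σ_{gen} Dᵢωᵢ + Σ_{load}(P̄ᵢ − fᵢ) = Σ P̄ᵢ − Σ fᵢ(δ) = 0`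
by `Σ P̄ᵢ = 0` [cite: Padiyar2013, §3.2 after eq (3.5)] and losslessness `Σ fᵢ = 0`
(model-2's `sum_Pbar_eq_zero`, `sum_pe_eq_zero`; the differential form of
`momentum_const_of_shifted`). [folklore] -/
theorem fderiv_phaseMomentum_phaseField {p : Params n} (hp : p.WellFormed) (hn : n ≠ 0)
    (x : (Fin n → ℝ) × (Fin n → ℝ)) :
    fderiv ℝ (phaseMomentum p) x (phaseField p x) = 0 := by
  set w := phaseField p x with hw
  have hγ : HasDerivAt (fun t : ℝ =>
      ((fun i => x.1 i + t * w.1 i, fun i => x.2 i + t * w.2 i) : (Fin n → ℝ) × (Fin n → ℝ)))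
      w 0 := by
    have h1 : HasDerivAt (fun t : ℝ => fun i => x.1 i + t * w.1 i) w.1 0 :=
      hasDerivAt_pi.2 fun i => by
        simpa using ((hasDerivAt_id (0 : ℝ)).mul_const (w.1 i)).const_add (x.1 i)
    have h2 : HasDerivAt (fun t : ℝ => fun i => x.2 i + t * w.2 i) w.2 0 :=
      hasDerivAt_pi.2 fun i => by
        simpa using ((hasDerivAt_id (0 : ℝ)).mul_const (w.2 i)).const_add (x.2 i)
    exact h1.prodMk h2
  have hL : DifferentiableAt ℝ (phaseMomentum p) x :=
    ((contDiff_phaseMomentum p).differentiable one_ne_zero) x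
  have hcomp : HasDerivAt (fun t : ℝ => phaseMomentum p
      ((fun i => x.1 i + t * w.1 i, fun i => x.2 i + t * w.2 i) : (Fin n → ℝ) × (Fin n → ℝ)))
      (fderiv ℝ (phaseMomentum p) x w) 0 :=
    hL.hasFDerivAt.comp_hasDerivAt_of_eq (0 : ℝ) hγ (by simp)
  have hlin : ∀ c d : ℝ, HasDerivAt (fun t : ℝ => c + t * d) d 0 := by
    intro c d
    simpa using ((hasDerivAt_id (0 : ℝ)).mul_const d).const_add c
  have hline : HasDerivAt (fun t : ℝ => phaseMomentum p
      ((fun i => x.1 i + t * w.1 i, fun i => x.2 i + t * w.2 i) : (Fin n → ℝ) × (Fin n → ℝ)))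
      (∑ i ∈ p.gen, p.M i * w.2 i + ∑ i, p.D i * w.1 i) 0 := by
    simp only [phaseMomentum_apply, Params.momentum]
    exact (HasDerivAt.fun_sum fun i _ => (hlin (x.2 i) (w.2 i)).const_mul (p.M i)).fun_add
      (HasDerivAt.fun_sum fun i _ => (hlin (x.1 i) (w.1 i)).const_mul (p.D i))
  rw [hcomp.unique hline]
  -- Σ_{gen} M w.2 = Σ_i M w.2 (M = 0 off gen), then bus balance, Σ P̄ = 0 and losslessness
  have hgen : ∑ i ∈ p.gen, p.M i * w.2 i = ∑ i, p.M i * w.2 i := by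
    apply Finset.sum_subset (Finset.subset_univ _)
    intro i _ hi
    simp [hp.M_eq_zero i hi]
  have hbal : ∀ i, p.M i * w.2 i + p.D i * w.1 i = p.Pbar i - p.pe x.1 i := fun i => by
    have h := phaseField_balance hp x i
    rw [hw]
    linarith
  rw [hgen, ← Finset.sum_add_distrib, Finset.sum_congr rfl fun i _ => hbal i,
    Finset.sum_sub_distrib, p.sum_Pbar_eq_zero (sum_D_pos hp hn).ne',
    p.sum_pe_eq_zero hp.b_symm, sub_zero]

/-- **The constraint set** of the assembly: the momentum level set through the equilibrium,
`L(δ, ω) = L(δ₀, 0)`, intersected with `{ωᵢ = 0 at every load bus}` (their `ωᵢ` is not a state of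
the printed model). MODELLED (MV-3). [folklore] -/
def constraintSet (p : Params n) (δ₀ : Fin n → ℝ) : Set ((Fin n → ℝ) × (Fin n → ℝ)) :=
  {x | p.momentum x.1 x.2 = p.momentum δ₀ 0 ∧ ∀ i, i ∉ p.gen → x.2 i = 0}

/-- The constraint set is closed. [folklore] -/
theorem isClosed_constraintSet (p : Params n) (δ₀ : Fin n → ℝ) :
    IsClosed (constraintSet p δ₀) := by
  have h1 : IsClosed {x : (Fin n → ℝ) × (Fin n → ℝ) | p.momentum x.1 x.2 = p.momentum δ₀ 0} := by
    have hc : Continuous fun x : (Fin n → ℝ) × (Fin n → ℝ) => p.momentum x.1 x.2 :=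
      (contDiff_phaseMomentum p).continuous
    exact isClosed_eq hc continuous_const
  have h2 : IsClosed {x : (Fin n → ℝ) × (Fin n → ℝ) | ∀ i, i ∉ p.gen → x.2 i = 0} := by
    simp only [setOf_forall]
    refine isClosed_iInter fun i => isClosed_iInter fun _ => ?_
    exact isClosed_eq ((continuous_apply i).comp continuous_snd) continuous_const
  simpa only [constraintSet, setOf_and] using h1.inter h2

/-- The equilibrium state `(δ₀, 0)` lies on the constraint set. [folklore] -/
theorem equilibrium_mem_constraintSet (p : Params n) (δ₀ : Fin n → ℝ) :
    ((δ₀, 0) : (Fin n → ℝ) × (Fin n → ℝ)) ∈ constraintSet p δ₀ :=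
  ⟨rfl, fun _ _ => rfl⟩

/-- **The constraint set is invariant along every solution (a priori).** If `X` solves
`X' = F(X)` on `[0, s]` (tree convention) and `X 0 ∈ constraintSet`, then `X t ∈ constraintSet` for
`t ∈ [0, s]`: both the momentum and each load-bus dummy frequency are first integrals
(`Literature.Analysis.ODE.apply_eq_of_fderiv_apply_eq_zero`). [folklore] -/
theorem mem_constraintSet_of_solution {p : Params n} (hp : p.WellFormed) (hn : n ≠ 0)
    (δ₀ : Fin n → ℝ) {X : ℝ → (Fin n → ℝ) × (Fin n → ℝ)} {s : ℝ}
    (hX : ∀ t ∈ Icc 0 s, HasDerivWithinAt X (phaseField p (X t)) (Icc 0 s) t)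
    (h0 : X 0 ∈ constraintSet p δ₀) : ∀ t ∈ Icc 0 s, X t ∈ constraintSet p δ₀ := by
  intro t ht
  have hLd : ∀ x, HasFDerivAt (phaseMomentum p) (fderiv ℝ (phaseMomentum p) x) x := fun x =>
    (((contDiff_phaseMomentum p).differentiable one_ne_zero) x).hasFDerivAt
  have hL := Literature.Analysis.ODE.apply_eq_of_fderiv_apply_eq_zero hLd
    (fun x => fderiv_phaseMomentum_phaseField hp hn x) hX ht
  simp only [phaseMomentum_apply] at hL
  refine ⟨hL.trans h0.1, fun i hi => ?_⟩
  -- the projection `x ↦ x.2 i` is a continuous linear first integral for `i ∉ gen`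
  set π₂ : ((Fin n → ℝ) × (Fin n → ℝ)) →L[ℝ] ℝ :=
    (ContinuousLinearMap.proj i).comp (ContinuousLinearMap.snd ℝ (Fin n → ℝ) (Fin n → ℝ)) with hπ₂
  have hπ : ∀ x : (Fin n → ℝ) × (Fin n → ℝ), π₂ x = x.2 i := fun x => rfl
  have hωd : ∀ x : (Fin n → ℝ) × (Fin n → ℝ), HasFDerivAt (fun y => π₂ y) (π₂) x := fun x =>
    π₂.hasFDerivAt
  have hω := Literature.Analysis.ODE.apply_eq_of_fderiv_apply_eq_zero (h := fun y => π₂ y)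
    (h' := fun _ => π₂) hωd (fun x => by rw [hπ]; exact phaseField_snd_of_not_mem p x hi) hX ht
  rw [hπ, hπ] at hω
  rw [hω]
  exact h0.2 i hi

/-! ### The window, the sublevel piece, compactness -/

/-- **The angle window**: every coupled branch strictly inside `|δᵢ − δⱼ| < π/2` (the polytope on
which the printed energy is a strict Lyapunov function for the internodal dynamics; model-2's
`StructurePreservingEnergy` / `…Definite`). Open. [folklore] -/
def window (p : Params n) : Set ((Fin n → ℝ) × (Fin n → ℝ)) :=
  {x | ∀ i j, p.b i j ≠ 0 → |x.1 i - x.1 j| < π / 2}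

/-- The window is open (a finite intersection of open slabs). [folklore] -/
theorem isOpen_window (p : Params n) : IsOpen (window p) := by
  simp only [window, setOf_forall]
  refine isOpen_iInter_of_finite fun i => isOpen_iInter_of_finite fun j =>
    isOpen_iInter_of_finite fun _ => ?_
  exact isOpen_lt (by fun_prop) continuous_const

/-- The threshold level `c⋆(θ, β) = g(θ)·β·(π/2 − θ)²/4` of model-2's `branch_abs_lt_of_energy_le`
(`g(θ) = (1 − sin θ)/(π/2 − θ)` the strict sector gain of [cite: VuTuritsyn2017, §IV-A]; `β` a lower
bound of the couplings on the edges of the coupling graph): below it, `V ≤ c` keeps every coupled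
branch strictly inside the window. [folklore] -/
def levelBound (θ β : ℝ) : ℝ :=
  (1 - Real.sin θ) / (π / 2 - θ) * β * (π / 2 - θ) ^ 2 / 4

/-- The threshold level is positive for `β > 0` and `0 ≤ θ < π/2` (so the region of the assembly
is a genuine neighbourhood of the equilibrium inside the constraint set). [folklore] -/
theorem levelBound_pos {θ β : ℝ} (hθ0 : 0 ≤ θ) (hθ : θ < π / 2) (hβ : 0 < β) :
    0 < levelBound θ β := by
  have hg : 0 < (1 - Real.sin θ) / (π / 2 - θ) :=
    Literature.MathematicalPhysics.PowerSystems.SinusoidalCoupling.sectorGain_pos hθ0 hθ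
  have hgap : 0 < (π / 2 - θ) ^ 2 := by
    have : 0 < π / 2 - θ := by linarith
    positivity
  unfold levelBound
  positivity

end Summit.Ventures.GridStability.Lyapunov.StructurePreserving

end
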